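import Summits.Ventures.PercRepro.GenQColoopCount

/-!
# PercRepro — the CHARGING form of the type-`2` balance (night-4, gen 2; sheet §45)

`Jq M G q 2 = Σ_{B ∈ R_q(G)} w(B)` with `w(B) = q·w_∞(B) − Φ_q·dem_2(B)`, and by `GenQColoopCount.lean` only the BASES
(`B.card = q`) can have `w(B) < 0`.  Distributing the weight of every spanning non-basis `B` in equal shares to the `nb(B)`
bases it contains gives the identity (`sum_nonbasis_eq_sum_charge`)
  `Σ_{B non-basis} w(B) = Σ_{B₀ basis} charge(B₀)`, `charge(B₀) = Σ_{B ⊋ B₀ spanning} w(B) / nb(B)`,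
so `Jq M G q 2 ≥ 0` as soon as `w(B₀) + charge(B₀) ≥ 0` for every basis `B₀` (`Jq_two_nonneg_of_charge`) — at `q = 5` a demanding
basis has `w = −1/3` and the charging data of `charge_t2.py` sit at `≥ 0.94`.
-/

namespace PercRepro.GenQ

open Finset ThmH SixFour

variable {α : Type*} [DecidableEq α] {M : Matroid α} [M.Finite]

/-- The type-`2` term of `B` in the balance of `G` at level `q`. -/
noncomputable def wTwo (M : Matroid α) [M.Finite] (G B : Finset α) (q : ℕ) : ℚ :=
  ((q : ℚ) + 2 - (2 : ℕ)) * wInf M B - (((q : ℚ) + 2) / ((q : ℚ) + 1)) * dem M G 2 B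

/-- The bases of `G` (rank-`q` subsets with `q` points). -/
noncomputable def basesOf (M : Matroid α) [M.Finite] (G : Finset α) (q : ℕ) : Finset (Finset α) :=
  (Rq M G q).filter (fun B => B.card = q)

/-- The number of bases inside `B`. -/
noncomputable def nb (M : Matroid α) [M.Finite] (G B : Finset α) (q : ℕ) : ℕ :=
  ((basesOf M G q).filter (fun B₀ => B₀ ⊆ B)).card

/-- The charge received by a basis `B₀` from the spanning non-bases above it. -/
noncomputable def charge (M : Matroid α) [M.Finite] (G : Finset α) (q : ℕ) (B₀ : Finset α) : ℚ :=
  ∑ B ∈ (Rq M G q).filter (fun B => B.card ≠ q ∧ B₀ ⊆ B), wTwo M G B q / nb M G B q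

/-- `Jq M G q 2` is the sum of the type-`2` terms. -/
theorem Jq_two_eq_sum_wTwo (G : Finset α) (q : ℕ) : Jq M G q 2 = ∑ B ∈ Rq M G q, wTwo M G B q := by
  rw [Jq_eq_sum_dem]
  apply Finset.sum_congr rfl
  intro B _
  unfold wTwo
  push_cast
  ring

/-- Every spanning set of rank `q` contains a basis. -/
theorem one_le_nb {G B : Finset α} {q : ℕ} (hB : B ∈ Rq M G q) : 1 ≤ nb M G B q := by
  obtain ⟨hBG, hr⟩ := mem_Rq.1 hB
  obtain ⟨I, hI⟩ := M.exists_isBasis' (B : Set α)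
  have hIB : I ⊆ (B : Set α) := hI.subset
  have hIfin : I.Finite := (Finset.finite_toSet B).subset hIB
  set I' : Finset α := hIfin.toFinset with hI'def
  have hI'B : I' ⊆ B := by
    intro x hx
    rw [hI'def, Set.Finite.mem_toFinset] at hx
    exact Finset.mem_coe.1 (hIB hx)
  have hI'coe : (I' : Set α) = I := by rw [hI'def, Set.Finite.coe_toFinset]
  have hcard : I'.card = q := by
    have h1 : (I' : Set α).encard = M.eRk (B : Set α) := by rw [hI'coe]; exact hI.encard_eq_eRk
    rw [Set.encard_coe_eq_coe_finsetCard, hr] at h1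
    exact_mod_cast h1
  have hrI : M.eRk (I' : Set α) = (q : ℕ∞) := by
    rw [hI'coe, hI.indep.eRk_eq_encard, ← hI'coe, Set.encard_coe_eq_coe_finsetCard, hcard]
  have hmem : I' ∈ (basesOf M G q).filter (fun B₀ => B₀ ⊆ B) := by
    rw [Finset.mem_filter]
    refine ⟨?_, hI'B⟩
    unfold basesOf
    rw [Finset.mem_filter]
    exact ⟨mem_Rq.2 ⟨hI'B.trans hBG, hrI⟩, hcard⟩
  unfold nb
  exact Finset.card_pos.2 ⟨I', hmem⟩

/-- **Double counting**: the weight of the spanning non-bases is the total charge of the bases. -/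
theorem sum_nonbasis_eq_sum_charge (G : Finset α) (q : ℕ) :
    ∑ B ∈ (Rq M G q).filter (fun B => B.card ≠ q), wTwo M G B q = ∑ B₀ ∈ basesOf M G q, charge M G q B₀ := by
  unfold charge
  have h : ∀ B ∈ (Rq M G q).filter (fun B => B.card ≠ q),
      wTwo M G B q = ∑ B₀ ∈ (basesOf M G q).filter (fun B₀ => B₀ ⊆ B), wTwo M G B q / nb M G B q := by
    intro B hB
    rw [Finset.sum_const, nsmul_eq_mul]
    have hnb : (nb M G B q : ℚ) ≠ 0 := by
      have := one_le_nb (Finset.mem_filter.1 hB).1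
      exact_mod_cast (by omega : nb M G B q ≠ 0)
    have hcard : (((basesOf M G q).filter (fun B₀ => B₀ ⊆ B)).card : ℚ) = (nb M G B q : ℚ) := by
      unfold nb
      rfl
    rw [hcard, mul_div_assoc', mul_comm, mul_div_assoc, div_self hnb, mul_one]
  rw [Finset.sum_congr rfl h, Finset.sum_sigma', Finset.sum_sigma']
  refine Finset.sum_bij' (fun p _ => ⟨p.2, p.1⟩) (fun p _ => ⟨p.2, p.1⟩) ?_ ?_ ?_ ?_ ?_
  · intro p hp
    simp only [Finset.mem_sigma, Finset.mem_filter] at hp ⊢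
    exact ⟨hp.2.1, hp.1.1, hp.1.2, hp.2.2⟩
  · intro p hp
    simp only [Finset.mem_sigma, Finset.mem_filter] at hp ⊢
    exact ⟨⟨hp.2.1, hp.2.2.1⟩, hp.1, hp.2.2.2⟩
  · intro p _
    rfl
  · intro p _
    rfl
  · intro p _
    rfl

/-- **The type-`2` balance is nonnegative when every basis is charged at least its deficit.** -/
theorem Jq_two_nonneg_of_charge (G : Finset α) (q : ℕ)
    (h : ∀ B₀ ∈ basesOf M G q, 0 ≤ wTwo M G B₀ q + charge M G q B₀) : 0 ≤ Jq M G q 2 := by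
  rw [Jq_two_eq_sum_wTwo]
  have hsplit : ∑ B ∈ Rq M G q, wTwo M G B q =
      ∑ B ∈ (Rq M G q).filter (fun B => B.card = q), wTwo M G B q +
        ∑ B ∈ (Rq M G q).filter (fun B => B.card ≠ q), wTwo M G B q := by
    rw [← Finset.sum_filter_add_sum_filter_not (Rq M G q) (fun B => B.card = q)]
  rw [hsplit, sum_nonbasis_eq_sum_charge]
  have : ∑ B ∈ (Rq M G q).filter (fun B => B.card = q), wTwo M G B q = ∑ B₀ ∈ basesOf M G q, wTwo M G B₀ q := rfl
  rw [this, ← Finset.sum_add_distrib]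
  exact Finset.sum_nonneg (fun B₀ hB₀ => h B₀ hB₀)

end PercRepro.GenQ
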